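/-
Copyright (c) 2026. All rights reserved.
Released under Apache 2.0 license as described in the file LICENSE.
Authors: abc-iut cell, seat abc-iut-w5-d144 (gen 5; row «H1PRIME-ELLIPTIC-MULTI», part 2: «Aut(E ∖ S) →
Out(π̂₁)» injective and the unconditional id-rigidity of «objects of EA mapping to E ∖ S»).
-/
import Literature.AnabelianGeometry.AbsoluteAnabelian.HolomorphicTorusComplFiniteAutExtension
import Literature.AnabelianGeometry.AbsoluteAnabelian.ArchimedeanHolFieldFunctorGeometricPSLTorusMinusFinite
import Literature.AnabelianGeometry.AbsoluteAnabelian.ArchimedeanHolFieldFunctorGeometricPuncturedTorusOuter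
import Mathlib.Topology.Algebra.Module.Cardinality
import HarnessLib

/-!
# (OUT) at `E ∖ S`, part 1: composition of twists, affine displacements, basis loops off a finite set

S. Mochizuki, *Topics in Absolute Anabelian Geometry III*, Lemma 4.3 and the proof of Prop. 4.2 (i),
kurims p.106. [cite: MochizukiAbsTopIII2015, Proposition 4.2 (i) p.106]

PROOF-ONLY file (abc-iut cell, seat abc-iut-w5-d144 gen 5, row «H1PRIME-ELLIPTIC-MULTI»; campaign-L R1.2,
NODES AbsTopIII:Prop4.2(i)/Cor4.5 geometric column).  The per-object residual (OUT) of
`ArchimedeanHolFieldFunctorGeometricOuterRigid` — «an automorphism of `𝕏` acting on `π̂₁(𝕏^top)` by an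
inner automorphism is trivial» — is DISCHARGED for the curves `𝕏 = E ∖ S` of type `(1, r)`, `r = |S| ≥ 1`
(`E = ℂ/Φ(ℤ²)`, `HolRS.ofOpens ⟨Sᶜ, _⟩`), extending the gen-4 case `r = 1`
(`ArchimedeanHolFieldFunctorGeometricPuncturedTorusOuter`).  Consequently «objects of `EA` mapping to
`E ∖ S`» is ID-RIGID with NO residual hypothesis (neither the (H1) criterion, false here, nor the
finiteness residuals `hfin`/`hN` of the uniformisation route are needed).

Proof of (OUT).  `σ ∈ Aut(E ∖ S)` is the restriction of an affine `H = ρ(M) + c` of `E` preserving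
`S` (`exists_affine_extension_of_iso_compl_finite`).  Step 1 (as for `r = 1`): a profinitely inner
twist `θ` (`σ_*(θ γ) = δ⁻¹ γ δ`) is invisible to the lattice coordinates `π₁(E ∖ S) → Λ`, so `ρ_ℝ(M)`
fixes the displacement of every loop of `E ∖ S` at a base point carrying the two lattice loops:
`M = 1`, `σ` is the translation by `c` on `E ∖ S`.  Step 2 (new): `c + S = S`, so `d • c = 0` for
`d = |S|`, and `σ^d = 1`.  Composing the twists (`twist_comp`), `θ^d` is the twist of `σ^d = id`
along the loop `ℓ = δ · σδ ⋯ σ^{d-1}δ`, i.e. conjugation by `ℓ`; with `ι θ = Ad(n⁻¹) ι` this makes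
`n^d ι(ℓ)⁻¹` central in `π̂₁(E ∖ S)`, which is centre-free: `n^d = ι(ℓ)`.  Reading the lattice
coordinates modulo `d` through the finite quotient `π̂₁ → (ℤ/d)²`: the coordinates of `D(ℓ) = d • D(δ)`
vanish mod `d`, i.e. `D(δ) ∈ Λ` — but `D(δ)` lifts `c`, so `c = 0` and `σ = 1`.

* `HolRS.twist_comp` — composition of twists along `σ₁`, `σ₂` (any space); `HolRS.untwist_id` — a
  twist along the identity is conjugation by the (loop) path;
* `HolRS.pathDisplacement_map_affine` — `D(H ∘ γ) = ρ_ℝ(M) D(γ)` for an affine `H` and loops `γ`;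
  `HolRS.latticeVec_single_injective'` — an integer matrix fixing `Φ(e₁), Φ(e₂)` is `1`;
* `HolRS.exists_basepoint_basis_loops_compl_finite` — a base point of `E ∖ S` carrying the two
  lattice loops.
Part 2 (`…TorusMinusFiniteOuter`) proves (OUT) at `E ∖ S` and the unconditional id-rigidity of
«objects of `EA` mapping to `E ∖ S`» from these.

Classical mathematics; no definition, no instance, no Prop-valued fact; nothing here bears on
[IUTchIII] Cor. 3.12; model ≠ reconstruction; support library, not a node.

## References

* S. Mochizuki, *Topics in Absolute Anabelian Geometry III*, kurims ms, Lemma 4.3 / Prop. 4.2 (i)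
  p.106. [MochizukiAbsTopIII2015]
* H. Lange, *Abelian Varieties over the Complex Numbers* (2023), §1.1.2 Prop. 1.1.6, §1.1.3 (1.3).
  [Lange2023AbelianVarietiesComplex]
* A. Hatcher, *Algebraic Topology* (2002), §1.1 (change of base point), Prop. 1B.9. [HatcherAT2002]
-/

set_option autoImplicit false

noncomputable section

open CategoryTheory Topology
open scoped Manifold ContDiff
open Literature.Topology.CoveringSpaces
open Literature.AlgebraicGeometry.Frobenioids (IsSlimGroup)
open Literature.IUT.HodgeTheaters (profiniteCompletion toCompletion)
open Literature.Geometry.Kaehler Literature.Geometry.Kaehler.ComplexTorus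
open Literature.AlgebraicTopology.FundamentalGroup

namespace Literature.AnabelianGeometry.AbsoluteAnabelian

namespace HolRS

/-! ### §1 Composition of twists -/

section Twist

variable {Y : Type*} [TopologicalSpace Y]

/-- `map` distributes over `trans` (classes of paths). [cite: HatcherAT2002, §1.1 (p. 27)] -/
private theorem quotient_map_trans {Z : Type*} [TopologicalSpace Z] {a b c : Y}
    (p : Path.Homotopic.Quotient a b) (q : Path.Homotopic.Quotient b c) (f : C(Y, Z)) :
    (p.trans q).map f = (p.map f).trans (q.map f) := by
  induction p using Path.Homotopic.Quotient.ind with | mk p =>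
  induction q using Path.Homotopic.Quotient.ind with | mk q =>
  rw [← Path.Homotopic.Quotient.mk_trans, ← Path.Homotopic.Quotient.mk_map, Path.map_trans,
    Path.Homotopic.Quotient.mk_trans, Path.Homotopic.Quotient.mk_map, Path.Homotopic.Quotient.mk_map]

/-- `map` commutes with `symm` (classes of paths). [cite: HatcherAT2002, §1.1 (p. 27)] -/
private theorem quotient_map_symm {Z : Type*} [TopologicalSpace Z] {a b : Y}
    (p : Path.Homotopic.Quotient a b) (f : C(Y, Z)) : p.symm.map f = (p.map f).symm := by
  induction p using Path.Homotopic.Quotient.ind with | mk p =>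
  rw [← Path.Homotopic.Quotient.mk_symm, ← Path.Homotopic.Quotient.mk_map,
    ← Path.Homotopic.Quotient.mk_map, ← Path.Homotopic.Quotient.mk_symm]
  exact congrArg Path.Homotopic.Quotient.mk (by ext t; rfl)

/-- Reversal of a composite (classes of paths). [cite: HatcherAT2002, §1.1 (p. 27)] -/
private theorem quotient_symm_trans_rev {a b c : Y} (p : Path.Homotopic.Quotient a b)
    (q : Path.Homotopic.Quotient b c) : (p.trans q).symm = q.symm.trans p.symm := by
  induction p using Path.Homotopic.Quotient.ind with | mk p =>
  induction q using Path.Homotopic.Quotient.ind with | mk q =>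
  rw [← Path.Homotopic.Quotient.mk_trans, ← Path.Homotopic.Quotient.mk_symm, Path.trans_symm,
    Path.Homotopic.Quotient.mk_trans, Path.Homotopic.Quotient.mk_symm, Path.Homotopic.Quotient.mk_symm]

/-- **Composition of twists.**  If `θ₁`, `θ₂` are twists of `π₁(Y, x)` along self-maps `σ₁`, `σ₂` and
paths `δ₁ : x ⇝ σ₁ x`, `δ₂ : x ⇝ σ₂ x` — `σᵢ ∘ (θᵢ γ) = δᵢ⁻¹ · γ · δᵢ` — then `θ₁ ∘ θ₂` is the twist along
`σ₂ ∘ σ₁` and the path `δ₂ · σ₂(δ₁) : x ⇝ σ₂ (σ₁ x)` (change of base point, Hatcher §1.1).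
[cite: HatcherAT2002, §1.1 Prop. 1.5 (change of base point)] -/
theorem twist_comp {x : Y} (σ₁ σ₂ : C(Y, Y)) (δ₁ : Path x (σ₁ x)) (δ₂ : Path x (σ₂ x))
    (θ₁ θ₂ : FundamentalGroup Y x → FundamentalGroup Y x)
    (h₁ : ∀ γ : FundamentalGroup Y x,
      Path.Homotopic.Quotient.map (FundamentalGroup.toPath (θ₁ γ)) σ₁ =
        (Path.Homotopic.Quotient.mk δ₁).symm.trans
          ((FundamentalGroup.toPath γ).trans (Path.Homotopic.Quotient.mk δ₁)))
    (h₂ : ∀ γ : FundamentalGroup Y x,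
      Path.Homotopic.Quotient.map (FundamentalGroup.toPath (θ₂ γ)) σ₂ =
        (Path.Homotopic.Quotient.mk δ₂).symm.trans
          ((FundamentalGroup.toPath γ).trans (Path.Homotopic.Quotient.mk δ₂)))
    (γ : FundamentalGroup Y x) :
    Path.Homotopic.Quotient.map (FundamentalGroup.toPath (θ₁ (θ₂ γ))) (σ₂.comp σ₁) =
      (Path.Homotopic.Quotient.mk (δ₂.trans (δ₁.map σ₂.continuous))).symm.trans
        ((FundamentalGroup.toPath γ).trans
          (Path.Homotopic.Quotient.mk (δ₂.trans (δ₁.map σ₂.continuous)))) := by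
  rw [Path.Homotopic.Quotient.map_comp, h₁ (θ₂ γ), quotient_map_trans, quotient_map_trans,
    quotient_map_symm, h₂ γ, ← Path.Homotopic.Quotient.mk_map, Path.Homotopic.Quotient.mk_trans,
    quotient_symm_trans_rev]
  simp only [Path.Homotopic.Quotient.trans_assoc]

/-- Untwisting along the identity: if `F = id` and `γ' ∘ F = ℓ⁻¹ · γ · ℓ` for a path `ℓ : x ⇝ F x`,
then `γ' = ℓ₀⁻¹ · γ · ℓ₀` for the loop `ℓ₀ = ℓ` at `x`. [cite: HatcherAT2002, §1.1 Prop. 1.5] -/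
theorem untwist_id {Y : Type*} [TopologicalSpace Y] {x : Y} (F : C(Y, Y))
    (hF : F = ContinuousMap.id Y) (ℓ : Path x (F x)) (p q : Path.Homotopic.Quotient x x)
    (h : Path.Homotopic.Quotient.map p F =
      (Path.Homotopic.Quotient.mk ℓ).symm.trans (q.trans (Path.Homotopic.Quotient.mk ℓ))) :
    p = (Path.Homotopic.Quotient.mk (ℓ.cast rfl (by rw [hF]; rfl))).symm.trans
      (q.trans (Path.Homotopic.Quotient.mk (ℓ.cast rfl (by rw [hF]; rfl)))) := by
  subst hF
  have hp : Path.Homotopic.Quotient.map p (ContinuousMap.id Y) = p := by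
    induction p using Path.Homotopic.Quotient.ind with | mk p =>
    rw [← Path.Homotopic.Quotient.mk_map]
    exact congrArg Path.Homotopic.Quotient.mk (by ext t; rfl)
  rw [hp] at h
  exact h


end Twist

/-! ### §2 Torus lemmas: affine maps and displacements, basis loops off a finite set -/

variable (Φ : (Fin 2 → ℝ) ≃L[ℝ] ℂ)

/-- **Displacement under an AFFINE continuous self-map of the torus**: if `H y = ρ(M) y + c` then for
every loop `γ` (any base point) `D(H ∘ γ) = ρ_ℝ(M) (D γ)` (the tree's
`pathDisplacement_map_eq_realRep_topRep` at base point `0`, moved by translation; `ρ_{ρ(M)} = M`).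
[cite: Lange2023AbelianVarietiesComplex, §1.1.3 (1.3)] [cite: HatcherAT2002, Prop. 1B.9] -/
theorem pathDisplacement_map_affine {H : ComplexTorus Φ → ComplexTorus Φ} (hH : Continuous H)
    (M : Matrix (Fin 2) (Fin 2) ℤ) (hHaff : ∀ y, H y = mapMatrix Φ Φ M y + H 0)
    {x : ComplexTorus Φ} (γ : Path x x) :
    pathDisplacement Φ (γ.map hH) = realRep Φ Φ M (pathDisplacement Φ γ) := by
  classical
  -- translate `γ` to a loop at `0`
  have hc : Continuous fun y : ComplexTorus Φ => y + (-x) := continuous_id.add continuous_const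
  let γ₀ : Path (0 : ComplexTorus Φ) 0 := (γ.map hc).cast (by simp) (by simp)
  have h₀ : pathDisplacement Φ γ₀ = pathDisplacement Φ γ := by
    have h1 : pathDisplacement Φ γ₀ = pathDisplacement Φ (γ.map hc) :=
      pathDisplacement_congr Φ _ _ (fun t => rfl)
    rw [h1, pathDisplacement_map_add_right]
  -- `H ∘ γ = (ρ(M) ∘ γ₀) + (ρ(M) x + H 0)`
  have hc' : Continuous fun y : ComplexTorus Φ => y + (mapMatrix Φ Φ M x + H 0) :=
    continuous_id.add continuous_const
  have h0 : mapMatrix Φ Φ M 0 = 0 := by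
    have h := mapMatrix_add (Φ := Φ) (Φ' := Φ) M 0 0
    rw [add_zero] at h
    simpa using h
  have hneg : mapMatrix Φ Φ M (-x) = -mapMatrix Φ Φ M x := by
    have h := mapMatrix_add (Φ := Φ) (Φ' := Φ) M x (-x)
    rw [add_neg_cancel, h0] at h
    exact (neg_eq_of_add_eq_zero_right h.symm).symm
  have h2 : pathDisplacement Φ (γ.map hH) =
      pathDisplacement Φ ((γ₀.map (continuous_mapMatrix M)).map hc') := by
    refine pathDisplacement_congr Φ _ _ (fun t => ?_)
    change H (γ t) = mapMatrix Φ Φ M (γ t + -x) + (mapMatrix Φ Φ M x + H 0)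
    rw [hHaff, mapMatrix_add, hneg]
    abel
  rw [h2, pathDisplacement_map_add_right,
    pathDisplacement_map_eq_realRep_topRep (continuous_mapMatrix M) γ₀, topRep_mapMatrix, h₀]

/-- An integer `2 × 2` matrix whose action on the lattice fixes `Φ(e₁)`, `Φ(e₂)` is the identity.
[cite: Lange2023AbelianVarietiesComplex, §1.1.3 (1.3) (folklore)] -/
theorem latticeVec_single_injective' {M : Matrix (Fin 2) (Fin 2) ℤ}
    (hM : ∀ i, latticeVec Φ (M.mulVec (Pi.single i 1)) = latticeVec Φ (Pi.single i 1)) : M = 1 := by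
  ext i j
  have h := hM j
  have h' : M.mulVec (Pi.single j 1) = Pi.single j 1 := by
    have hinj : Function.Injective (latticeVec Φ) := by
      intro a b hab
      have := Φ.injective hab
      funext k
      exact_mod_cast congrFun this k
    exact hinj h
  have hij : M i j = (Pi.single j (1 : ℤ) : Fin 2 → ℤ) i := by
    have := congrFun h' i
    rwa [Matrix.mulVec_single_one] at this
  rw [hij, Matrix.one_apply, Pi.single_apply]

/-- **A base point of `E ∖ S` carrying the two basic lattice loops**: for `S ⊆ E = ℂ/Φ(ℤ²)` finite,
some `x′ = π(Φ(a, b)) ∉ S` has, for `i = 0, 1`, the straight segment from `Φ(a,b)` to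
`Φ(a,b) + Φ(e_i)` projecting to a loop INSIDE `E ∖ S` with displacement `Φ(e_i)` (choose the two
coordinates off the countably many values for which the horizontal / vertical circle meets `S`).
[cite: Lange2023AbelianVarietiesComplex, §1.1.3 (1.3)] -/
theorem exists_basepoint_basis_loops_compl_finite {S : Set (ComplexTorus Φ)} (hS : S.Finite) :
    ∃ x' : ↥(Sᶜ), ∀ i : Fin 2, ∃ γ : Path x' x',
      pathDisplacement Φ (γ.map continuous_subtype_val) = latticeVec Φ (Pi.single i 1) := by
  classical
  -- lifts of the points of `S`
  have hlift : ∀ s : ComplexTorus Φ, ∃ v : Fin 2 → ℝ, cover Φ (Φ v) = s := fun s => by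
    obtain ⟨z, hz⟩ := cover_surjective Φ s
    exact ⟨Φ.symm z, by rw [ContinuousLinearEquiv.apply_symm_apply, hz]⟩
  choose v hv using hlift
  -- the bad coordinate values: countably many
  set B : Fin 2 → Set ℝ := fun j => ⋃ s ∈ S, Set.range fun n : ℤ => v s j + n with hB
  have hBc : ∀ j, (B j).Countable := fun j =>
    (hS.countable.biUnion fun s _ => Set.countable_range _)
  have hBne : ∀ j, ((B j)ᶜ).Nonempty := fun j => ((hBc j).dense_compl ℝ).nonempty
  obtain ⟨a, ha⟩ := hBne 0
  obtain ⟨b, hb⟩ := hBne 1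
  let w : Fin 2 → ℝ := fun j => if j = 0 then a else b
  have hw : ∀ j, w j ∉ B j := fun j => by
    fin_cases j
    · exact ha
    · exact hb
  let e : Fin 2 → Fin 2 → ℝ := fun i j => ((Pi.single i (1 : ℤ) : Fin 2 → ℤ) j : ℝ)
  have he : ∀ i, Φ (e i) = latticeVec Φ (Pi.single i 1) := fun i => rfl
  -- the segment `w + t e_i` keeps its `i+1`-coordinate equal to `w (i+1)`, hence misses `S`
  have hmem : ∀ (i : Fin 2) (t : ℝ), cover Φ (Φ (w + t • e i)) ∈ (Sᶜ : Set (ComplexTorus Φ)) := by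
    intro i t hmemS
    -- the other coordinate
    set j : Fin 2 := i + 1 with hj
    have hne : j ≠ i := by
      intro h; have := congrArg Fin.val h; fin_cases i <;> simp [hj] at this
    have hcoord : (w + t • e i) j = w j := by
      simp [e, Pi.single_apply, hne]
    -- `π(Φ(w + t e_i)) = s = π(Φ(v s))` forces `w j - v s j ∈ ℤ`
    set s : ComplexTorus Φ := cover Φ (Φ (w + t • e i)) with hs
    obtain ⟨n, hn⟩ := (cover_eq_cover_iff Φ (Φ (w + t • e i)) (Φ (v s))).1 (hv s).symm
    have hn' : w + t • e i = v s + fun k => (n k : ℝ) := by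
      apply Φ.injective
      rw [hn, Φ.map_add (v s)]
      rfl
    have hj' : w j = v s j + n j := by
      have := congrFun hn' j
      rwa [hcoord] at this
    exact hw j (Set.mem_iUnion₂.2 ⟨s, hmemS, n j, hj'.symm⟩)
  have hmem0 : cover Φ (Φ w) ∈ (Sᶜ : Set (ComplexTorus Φ)) := by
    have h := hmem 0 0
    simpa using h
  refine ⟨⟨cover Φ (Φ w), hmem0⟩, fun i => ?_⟩
  let L : C(unitInterval, ℂ) :=
    ⟨fun t => Φ (w + (t : ℝ) • e i),
      Φ.continuous.comp (continuous_const.add (continuous_subtype_val.smul continuous_const))⟩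
  have hL1 : Φ (w + (1 : ℝ) • e i) = Φ w + latticeVec Φ (Pi.single i 1) := by
    rw [one_smul, map_add, he]
  let γ : Path (⟨cover Φ (Φ w), hmem0⟩ : ↥(Sᶜ)) ⟨cover Φ (Φ w), hmem0⟩ :=
    { toFun := fun t => ⟨cover Φ (L t), hmem i t⟩
      continuous_toFun := ((continuous_cover Φ).comp L.continuous).subtype_mk _
      source' := by
        apply Subtype.ext
        change cover Φ (Φ (w + ((0 : unitInterval) : ℝ) • e i)) = cover Φ (Φ w)
        simp
      target' := by
        apply Subtype.ext
        change cover Φ (Φ (w + ((1 : unitInterval) : ℝ) • e i)) = cover Φ (Φ w)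
        rw [Set.Icc.coe_one, hL1, cover_add_latticeVec] }
  refine ⟨γ, ?_⟩
  rw [pathDisplacement_eq_sub_of_lift Φ _ (Γ := L) L.continuous (fun t => rfl)]
  change Φ (w + ((1 : unitInterval) : ℝ) • e i) - Φ (w + ((0 : unitInterval) : ℝ) • e i) = _
  rw [Set.Icc.coe_one, Set.Icc.coe_zero, hL1, zero_smul, add_zero, add_sub_cancel_left]

end HolRS

end Literature.AnabelianGeometry.AbsoluteAnabelian

end
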